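import Summits.ABC.ABC.Theorems.DefiniteXiEisensteinQuarantineForcedPairOccurrence
import Literature.NumberTheory.Automorphic.BrandtWeightedPairing
import Literature.NumberTheory.Automorphic.BrandtModuleWeightSymmProofs
import Literature.NumberTheory.Automorphic.BrandtEigenvectorDegreeZero
import Literature.NumberTheory.Automorphic.EichlerSubidealCount
import HarnessLib

/-!
# Brandt-side tools for the research stub `stub_forcedPairOccurrence` (crux `EisensteinQuarantine`,
# stmt-ABC-15023, line `forced-pair-dlog`): Hecke boundaries, orthogonality, the isotropic lift, Eisenstein congruence

Support file (`--supports stmt-ABC-15023`) written by the stub-plan prover of `stub_forcedPairOccurrence`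
(STUB-PLAN-stub_forcedPairOccurrence.md §2 entries 20–25: ideator k3's Plan B/C helpers and k1's support lemmas, all
"≤ one cycle", here PROVED), plus one unconditional lower-bound mechanism for `ξ` that the tree did not have.
Everything is pure `ℤ`-linear algebra of the weighted pairing `⟪x, y⟫_w = Σ_i w_i x_i y_i` (`BrandtWeightedPairing.lean`)
and of a Brandt setup `S` (`Brandt.XiSetup`); no named fact is used.

* `occurrence_of_heckeBoundary` (k3 B-H3) — for a family of `w`-symmetric integer matrices with common eigenvector `φ`
  on `s`, a HECKE-BOUNDARY decomposition `φ = Σ_{p ∈ s} (T_p − λ_p) y_p + m z` yields the occurrence witness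
  `ψ := φ − m z`: `⟪ψ, φ⟫_w = 0` (self-adjointness `Brandt.wpair_mulVec`) and `φ ≡ ψ (mod m)`.
  (The research hypothesis `FreyHeckeBoundaryDepth` — k3 K_B: the Frey vector is a Hecke boundary modulo
  `2^{v₂(q−1)−c}` — and its reduction to the registered stub live in the sibling file
  `DefiniteXiEisensteinQuarantineHeckeBoundaryDepth.lean`, so that this file stays definition-free.)
* `wpair_eq_zero_of_eigenvalue_ne` (k1 H4) — eigenvectors of a `w`-symmetric matrix with distinct eigenvalues are
  `w`-orthogonal.
* `wnorm_sub_wnorm_dvd` (k3 C-H4) — `Σ w_i φ_i²` modulo `2^{k+1}` depends only on `φ` modulo `2^k` (`k ≥ 1`);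
  `dvd_xi_of_isotropic_lift` (k3 C-H4′) — to get `2^K ∣ ξ_S` on an eigen-line it suffices to exhibit ANY integer vector
  `φ' ≡ φ (mod 2^{K−1})` with `2^K ∣ Σ w_i φ'_i²` (then `forcedPairOccurrence_of_dvd_xi`, p132787, gives the stub at `c + 2`).
* `dvd_wnorm_of_weight_mul_congr` / `dvd_xi_of_weight_mul_congr` (NEW, unconditional) — the EISENSTEIN-CONGRUENCE
  mechanism: if the weighted coordinates `w_i φ_i` of the generator of the `a(E)`-eigen-line are congruent to a constant
  `μ` modulo `m`, then `m ∣ ξ_S`, because `Σ_i w_i φ_i² = Σ_i φ_i (w_i φ_i − μ) + μ Σ_i φ_i` and cuspidal eigenvectors have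
  DEGREE ZERO (`Brandt.sum_eq_zero_of_eigenLattice_eq_span` + Eichler's column sums `Brandt.XiSetup.sum_matrix_prime_eq`
  + Hasse `a_p ≠ p + 1`, all landed).  This is the depth contributed by the congruence of `φ_E` with Gross's Eisenstein
  vector ALONE ("individual depth", bounded by the 2-adic Eisenstein congruence of `f_E` itself — expected `O(1)` on the
  forced family, whose depth `v₂(q−1) − c` must come from the breadth of the Eisenstein cluster); recorded as the first
  unconditional lower-bound mechanism for `ξ` in the tree and as the `s = ∅` case of the Hecke-boundary criterion.

## References

* [Gross1987] B. H. Gross, Heights and the special values of L-series (1987), §§1–4 (the pairing, the Eisenstein vector).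
* [Eichler1973] M. Eichler, LNM 320 (1973), Ch. II §6 (16)–(17) (column sums `p + 1`, weight symmetry).
* [Mazur1977] B. Mazur, Publ. Math. IHÉS 47 (1977), II.16.6, II.18.10 (the Eisenstein ideal in the supersingular module).
-/

-- `Summit.<Summit>.<Problem>`: for the single-conjunct summit `ABC` the duplicate `ABC.ABC` is mandated.
set_option linter.dupNamespace false

noncomputable section

namespace Summit.ABC.ABC.Theorems

open scoped BigOperators Matrix
open Literature.NumberTheory.Automorphic Literature.NumberTheory.EllipticCurves

/-! ## Hecke boundaries give occurrence witnesses -/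

/-- **A Hecke boundary modulo `m` occurs modulo `m` in its own `w`-orthogonal complement** (k3 B-H3).  Let `w` be
weights, `T p` (`p ∈ s`) integer matrices that are `w`-symmetric (`w_i (T p)_ij = w_j (T p)_ji`) with a common
eigenvector `φ`, `T p φ = λ_p φ`.  If `φ = Σ_{p ∈ s} (T p y_p − λ_p y_p) + m z`, then `ψ := φ − m z` satisfies
`⟪ψ, φ⟫_w = Σ_p (⟪y_p, T p φ⟫_w − λ_p ⟪y_p, φ⟫_w) = 0` (`Brandt.wpair_mulVec`) and `φ − ψ = m z`. [folklore] -/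
theorem occurrence_of_heckeBoundary {ι : Type*} [Fintype ι] {P : Type*} (w : ι → ℕ)
    (T : P → Matrix ι ι ℤ) (lam : P → ℤ) (s : Finset P)
    (hT : ∀ p ∈ s, ∀ i j, (w i : ℤ) * T p i j = (w j : ℤ) * T p j i)
    {φ : ι → ℤ} (hφ : ∀ p ∈ s, T p *ᵥ φ = lam p • φ)
    (m : ℤ) (y : P → ι → ℤ) (z : ι → ℤ)
    (h : φ = ∑ p ∈ s, (T p *ᵥ y p - lam p • y p) + m • z) :
    ∃ ψ : ι → ℤ, ∑ i, (w i : ℤ) * ψ i * φ i = 0 ∧ ∀ i, m ∣ φ i - ψ i := by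
  refine ⟨∑ p ∈ s, (T p *ᵥ y p - lam p • y p), ?_, fun i => ⟨z i, ?_⟩⟩
  · rw [Brandt.wpair_sum_left]
    refine Finset.sum_eq_zero fun p hp => ?_
    -- `⟪T y − λ y, φ⟫ = ⟪y, T φ⟫ − λ ⟪y, φ⟫ = λ ⟪y, φ⟫ − λ ⟪y, φ⟫`
    have hsplit : ∑ i, (w i : ℤ) * (T p *ᵥ y p - lam p • y p) i * φ i =
        ∑ i, (w i : ℤ) * (T p *ᵥ y p) i * φ i - ∑ i, (w i : ℤ) * (lam p • y p) i * φ i := by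
      rw [← Finset.sum_sub_distrib]
      exact Finset.sum_congr rfl fun i _ => by rw [Pi.sub_apply]; ring
    rw [hsplit, Brandt.wpair_mulVec w (hT p hp) (y p) φ, hφ p hp, Brandt.wpair_smul_left,
      Brandt.wpair_smul_right, sub_self]
  · have := congrFun h i
    simp only [Pi.add_apply, Pi.smul_apply, smul_eq_mul] at this
    linear_combination this

/-- **`w`-orthogonality of eigenvectors with distinct eigenvalues** (k1 H4): for a `w`-symmetric integer matrix `X`
with `X φ = a φ`, `X ψ = b ψ` and `a ≠ b`, `⟪ψ, φ⟫_w = 0` — `a ⟪ψ, φ⟫ = ⟪ψ, X φ⟫ = ⟪X ψ, φ⟫ = b ⟪ψ, φ⟫`. [folklore] -/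
theorem wpair_eq_zero_of_eigenvalue_ne {ι : Type*} [Fintype ι] (w : ι → ℕ) {X : Matrix ι ι ℤ}
    (hX : ∀ i j, (w i : ℤ) * X i j = (w j : ℤ) * X j i) {φ ψ : ι → ℤ} {a b : ℤ}
    (hφ : X *ᵥ φ = a • φ) (hψ : X *ᵥ ψ = b • ψ) (hab : a ≠ b) :
    ∑ i, (w i : ℤ) * ψ i * φ i = 0 := by
  have h1 : ∑ i, (w i : ℤ) * (X *ᵥ ψ) i * φ i = ∑ i, (w i : ℤ) * ψ i * (X *ᵥ φ) i :=
    Brandt.wpair_mulVec w hX ψ φ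
  rw [hψ, hφ, Brandt.wpair_smul_left, Brandt.wpair_smul_right] at h1
  have h2 : (b - a) * ∑ i, (w i : ℤ) * ψ i * φ i = 0 := by rw [sub_mul, h1, sub_self]
  rcases mul_eq_zero.mp h2 with h | h
  · exact absurd (sub_eq_zero.mp h).symm hab
  · exact h

/-! ## The norm refinement and the isotropic lift (k3 C-H4, C-H4′) -/

/-- **`Σ w_i φ_i²` modulo `2^{k+1}` depends only on `φ` modulo `2^k`** (`k ≥ 1`): termwise
`φ_i² − φ'_i² = (φ_i − φ'_i)² + 2 φ'_i (φ_i − φ'_i)` and `2k ≥ k + 1`. [folklore] -/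
theorem wnorm_sub_wnorm_dvd {ι : Type*} [Fintype ι] (w : ι → ℕ) {φ φ' : ι → ℤ} {k : ℕ} (hk : 1 ≤ k)
    (h : ∀ i, (2 : ℤ) ^ k ∣ φ i - φ' i) :
    (2 : ℤ) ^ (k + 1) ∣ ∑ i, (w i : ℤ) * φ i ^ 2 - ∑ i, (w i : ℤ) * φ' i ^ 2 := by
  rw [← Finset.sum_sub_distrib]
  refine Finset.dvd_sum fun i _ => ?_
  obtain ⟨d, hd⟩ := h i
  have hφ : φ i = φ' i + 2 ^ k * d := by linear_combination hd
  have hkk : (2 : ℤ) ^ (k + 1) ∣ (2 : ℤ) ^ k * (2 : ℤ) ^ k :=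
    ⟨2 ^ (k - 1), by rw [← pow_add, ← pow_add]; congr 1; omega⟩
  have h1 : (2 : ℤ) ^ (k + 1) ∣ (w i : ℤ) * (2 ^ k * d) ^ 2 := by
    rw [show (w i : ℤ) * (2 ^ k * d) ^ 2 = 2 ^ k * 2 ^ k * ((w i : ℤ) * d ^ 2) by ring]
    exact hkk.mul_right _
  have h2 : (2 : ℤ) ^ (k + 1) ∣ (w i : ℤ) * (2 * φ' i * (2 ^ k * d)) := by
    rw [show (w i : ℤ) * (2 * φ' i * (2 ^ k * d)) = 2 ^ (k + 1) * ((w i : ℤ) * φ' i * d) by ring]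
    exact Dvd.intro _ rfl
  have : (w i : ℤ) * φ i ^ 2 - (w i : ℤ) * φ' i ^ 2 =
      (w i : ℤ) * (2 ^ k * d) ^ 2 + (w i : ℤ) * (2 * φ' i * (2 ^ k * d)) := by
    rw [hφ]; ring
  rw [this]
  exact h1.add h2

/-- **The isotropic-lift criterion** (k3 C-H4′): on an eigen-line `ℤ φ` of a Brandt setup `S`, to get `2^K ∣ ξ_S(λ)`
(`K ≥ 2`) it suffices to exhibit ANY integer vector `φ' ≡ φ (mod 2^{K−1})` — not necessarily an eigenvector, not
necessarily orthogonal to anything — with `2^K ∣ Σ_i w_i φ'_i²`: by `wnorm_sub_wnorm_dvd` at `k = K − 1` and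
`Σ_i w_i φ_i² = ξ_S` on the line (`sum_weight_mul_sq_eq_xi`).  With `forcedPairOccurrence_of_dvd_xi` (p132787) this is the
most flexible sufficient condition for the stub on the Brandt side. [folklore] -/
theorem dvd_xi_of_isotropic_lift {Nplus Nminus : ℕ} (S : Brandt.XiSetup Nplus Nminus) (lam : ℕ → ℤ)
    [Fintype (Brandt.ClassSet S.O)] {φ : Brandt.ClassSet S.O → ℤ} (hφ : φ ≠ 0)
    (hL : Brandt.eigenLattice (Nplus * Nminus) (Brandt.matrix S.O) lam = ℤ ∙ φ)
    {K : ℕ} (hK : 2 ≤ K) (φ' : Brandt.ClassSet S.O → ℤ)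
    (hcong : ∀ i, (2 : ℤ) ^ (K - 1) ∣ φ i - φ' i)
    (hiso : (2 : ℤ) ^ K ∣ ∑ i, (Brandt.weight S.O i : ℤ) * φ' i ^ 2) :
    2 ^ K ∣ S.xi lam := by
  have hdiff := wnorm_sub_wnorm_dvd (Brandt.weight S.O) (k := K - 1) (by omega) hcong
  rw [show K - 1 + 1 = K by omega] at hdiff
  have hsum : (2 : ℤ) ^ K ∣ ∑ i, (Brandt.weight S.O i : ℤ) * φ i ^ 2 := by
    have := hdiff.add hiso
    rwa [sub_add_cancel] at this
  rw [sum_weight_mul_sq_eq_xi S lam hφ hL] at hsum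
  exact_mod_cast hsum

/-! ## The Eisenstein-congruence mechanism: constant weighted coordinates modulo `m` force `m ∣ ξ` -/

/-- **Degree zero + weighted coordinates constant modulo `m` ⟹ `m ∣ Σ w_i φ_i²`**: if `Σ_i φ_i = 0` and
`w_i φ_i ≡ μ (mod m)` for all `i`, then `m ∣ Σ_i w_i φ_i²`, since `Σ_i w_i φ_i² = Σ_i φ_i (w_i φ_i − μ) + μ Σ_i φ_i`.
[folklore] -/
theorem dvd_wnorm_of_weight_mul_congr {ι : Type*} [Fintype ι] (w : ι → ℕ) {φ : ι → ℤ}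
    (hdeg : ∑ i, φ i = 0) {m μ : ℤ} (hcong : ∀ i, m ∣ (w i : ℤ) * φ i - μ) :
    m ∣ ∑ i, (w i : ℤ) * φ i ^ 2 := by
  have hsplit : ∑ i, (w i : ℤ) * φ i ^ 2 = ∑ i, φ i * ((w i : ℤ) * φ i - μ) + μ * ∑ i, φ i := by
    rw [Finset.mul_sum, ← Finset.sum_add_distrib]
    exact Finset.sum_congr rfl fun i _ => by ring
  rw [hsplit, hdeg, mul_zero, add_zero]
  exact Finset.dvd_sum fun i _ => (hcong i).mul_left _

/-- **The Eisenstein congruence of the Frey vector bounds `ξ` from below, unconditionally.**  Let `S` be a Brandt setup of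
type `(N⁺, N⁻)`, `W/ℚ` elliptic, `ℤ φ` (`φ ≠ 0`) the `a(W)`-eigen-lattice of the Brandt matrices, and `p ∤ N⁺N⁻` a
prime.  If the weighted coordinates are congruent to a constant, `w_i φ_i ≡ μ (mod m)` for all classes `i` — i.e.
`h = (w_i φ_i)_i`, the transposed eigenvector, is congruent modulo `m` to a multiple of Gross's Eisenstein vector
`(1, …, 1)` — then `m ∣ ξ_S(a(W))`.  Proof: `φ` has degree zero (`Brandt.sum_eq_zero_of_eigenLattice_eq_span`: Eichler's
column sums `Σ_i B(p)_ij = p + 1`, `Brandt.XiSetup.sum_matrix_prime_eq`, and Hasse `a_p(W) ≠ p + 1`,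
`WeierstrassCurve.lFunction_ne_prime_add_one`), then `dvd_wnorm_of_weight_mul_congr` and `Σ_i w_i φ_i² = ξ_S` on the line
(`sum_weight_mul_sq_eq_xi`).  This is the `s = ∅` shadow of the Hecke-boundary criterion: the depth of the INDIVIDUAL
Eisenstein congruence of `φ_E` is a lower bound for `v₂ ξ`. [cite: Gross1987, §2 (Eisenstein vector and degree)] -/
theorem dvd_xi_of_weight_mul_congr {Nplus Nminus : ℕ} (S : Brandt.XiSetup Nplus Nminus)
    [Fintype (Brandt.ClassSet S.O)] (W : WeierstrassCurve ℚ) [W.IsElliptic]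
    {φ : Brandt.ClassSet S.O → ℤ} (hφ : φ ≠ 0)
    (hL : Brandt.eigenLattice (Nplus * Nminus) (Brandt.matrix S.O) (fun n => W.LFunction n) = ℤ ∙ φ)
    {p : ℕ} (hp : p.Prime) (hpN : ¬ p ∣ Nplus * Nminus) {m μ : ℤ}
    (hcong : ∀ i, m ∣ (Brandt.weight S.O i : ℤ) * φ i - μ) :
    m ∣ (S.xi (fun n => W.LFunction n) : ℤ) := by
  have hdeg : ∑ i, φ i = 0 :=
    Brandt.sum_eq_zero_of_eigenLattice_eq_span hL hp hpN (fun j => S.sum_matrix_prime_eq hp hpN j)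
      (W.lFunction_ne_prime_add_one hp)
  rw [← sum_weight_mul_sq_eq_xi S _ hφ hL]
  exact dvd_wnorm_of_weight_mul_congr (Brandt.weight S.O) hdeg hcong

end Summit.ABC.ABC.Theorems

end
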